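import Mathlib
import HarnessLib
import Summits.HubbardSuperconductivity.HubbardSuperconductivity.Theorems.KLProgrammeForwardBubbleSoftSharpTC
import Summits.HubbardSuperconductivity.HubbardSuperconductivity.Theorems.KLProgrammeForwardBubbleRayTubeQuasi
import Summits.HubbardSuperconductivity.HubbardSuperconductivity.Theorems.KLProgrammeKLRegimeSplitThermalLayerSharpZSQuasi

/-!
# Route `KLProgramme` — ENGINE stmt-HubbardSuperconductivity-20437 `KLRegimeEngineV17F2`, row (c) value lane / class-#5 STEP (X).3 pinned pair: the SOFT forward slice bubble
# with the SHARP zero-sound term, SPLIT Matsubara count, and TUBE-LOCAL QUASI-LIPSCHITZ vertex data (brick (L3)-2 of cure (A″) route 3′ of located «(c)-OUT-COOPER-ANTIPODE»;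
# cell gate-hubbard-kl, seat hubbard-kl-k3c2-p2 g26, technique «thermal-bar induction n ≤ nScales β + 1 with EngineBoundsAtV4S sums»)

WHY.  The member rows of record are built on `klfs_*TC` (…ForwardBubbleSoftSharpTC, g22): the insertion `W_θ(e) = J_θ(e)·A(rayPt_θ(e))` is asked to be Lipschitz at `e = 0`
through a GLOBAL, angle-uniform radial Lipschitz constant `A₁` of the vertex weight `A` — vacuous near the Cooper antipode at deep scales (COOPER-ANTIPODE.md).  On route 3′ the
weight is the global McShane extension of lattice pins and a CELL of lattice data supplies, on the tube segment of each ray, a QUASI-Lipschitz datum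
`‖A(t·dir θ) − A(t'·dir θ)‖ ≤ A₁(θ)|t − t'| + δ_A(θ)` (`klpe_ext_quasi_lipschitz_of_cell`).  Text-faithful twins (suffix `TCQ`) of the four `…TC` lemmas:
* `klfs_transfer_norm_le_of_lipschitz_coreTCQ`, `klfs_transfer_norm_le_of_lipschitzTCQ` — the bubble at transfer with `‖W e − W 0‖ ≤ L_W|e| + δ_W` (zero-transfer part from
  `klte_slice_bubble_weighted_norm_le_sharp_quasi`: `+ (128/π)·M_F·δ_W`);
* **`klfs_ray_bubble_norm_le_of_lipschitzTCQ`** — one ray, sup `A₀` and quasi-Lipschitz `(A₁, δ_A)` asked only on the ray's TUBE segment (`|band| < 4Λₙ`, `t ≥ 0`); the bound gains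
  the SCALE-FREE defect `(128/π)·M_F·(π√2/(Dt_min − κ₁))·δ_A`;
* **`klfs_planar_bubble_norm_le_of_lipschitzTCQ`** — the plane, with ANGLE PROFILES `A₀(θ), A₁(θ), δ_A(θ)` (integrable on `(−π, π)`): the planar bound is the θ-INTEGRAL of the
  per-ray bound (coarea `klry_norm_smul_sum_integral_le_of_ray_bound_fn`).
`δ_A = 0`, constant profiles recover `…TC` (up to `∫dθ = 2π`).  Pure analysis on the tree's objects; nothing about the model is asserted; nothing asserts (X).3, (c), K3 or
superconductivity.  References: BGM 2006 §2.5 (2.56b)–(2.56e) [cite: BenfattoGiulianiMastropietro2006].  0 kit · 0 lit.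
-/

noncomputable section

namespace Summit.HubbardSuperconductivity.HubbardSuperconductivity.Theorems.KLRegimeSplit

set_option linter.dupNamespace false -- summit = problem name (single-conjunct summit), D-0017

open Real Set Filter MeasureTheory intervalIntegral Complex Literature.MathematicalPhysics.QuantumLattice
open Literature.MathematicalPhysics.QuantumLattice.BandSectorCounting Literature.Probability.LatticeModels
open Summit.HubbardSuperconductivity.HubbardSuperconductivity.Theorems.PerturbedFermiCurve
open Summit.HubbardSuperconductivity.HubbardSuperconductivity.Theorems.KLProgrammeLegKernels
open Summit.HubbardSuperconductivity.HubbardSuperconductivity.Theorems.DispersionFlow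

/-! ## §1 The bubble at transfer: sharp zero-transfer part with a quasi-Lipschitz insertion + split shift -/

section Transfer
variable {f f' : ℝ → ℂ} {Lf Mf LF MF ℓ K' : ℝ} {W : ℝ → ℂ} {σ : ℝ → ℝ} {LW BW δW δmax : ℝ}

/-- **The slice bubble AT TRANSFER, second line by its joint Lipschitz constant, QUASI-Lipschitz insertion (global form).**  As
`klfs_transfer_norm_le_of_lipschitz_coreTC` with `‖W(e) − W(0)‖ ≤ L_W|e| + δ_W` on `|e| < 4Λₙ` (`0 ≤ δ_W`); the bound gains `(128/π)·M_F·δ_W`. -/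
theorem klfs_transfer_norm_le_of_lipschitz_coreTCQ
    (hlip : ∀ s s', ‖f s - f s'‖ ≤ Lf * |s - s'|) (hbd : ∀ s, ‖f s‖ ≤ Mf) {n : ℕ}
    (hin : ∀ s, s ≤ (klScale klE0 n / 2) ^ 2 → f s = 0) (hout : ∀ s, (4 * klScale klE0 n) ^ 2 ≤ s → f s = 0)
    (hK' : 0 ≤ K') (hΨlip : ∀ k₀ e k₀' e', ‖klfb_prop f' k₀ e - klfb_prop f' k₀' e'‖ ≤ K' * (|k₀ - k₀'| + |e - e'|))
    (hMF : 0 ≤ MF) (hFlip : ∀ s s', ‖f s * f' s - f s' * f' s'‖ ≤ LF * |s - s'|) (hFbd : ∀ s, ‖f s * f' s‖ ≤ MF)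
    (hLF : LF ≤ ℓ / klScale klE0 n ^ 2)
    (hW : Continuous W) (hLW : 0 ≤ LW) (hδW : 0 ≤ δW) (hBW : 0 ≤ BW)
    (hWlip : ∀ e : ℝ, |e| < 4 * klScale klE0 n → ‖W e - W 0‖ ≤ LW * |e| + δW)
    (hWbd : ∀ e, |e| < 4 * klScale klE0 n → ‖W e‖ ≤ BW)
    (hσc : Continuous σ) (hδ0 : 0 ≤ δmax) (hσ : ∀ e, |σ e| ≤ δmax)
    (q₀ : ℝ) {β : ℝ} (hβ : klBetaMin ≤ β) (hn : n ≤ nScales β + 1) {M : ℕ}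
    (hM : β * (4 * klScale klE0 n) / (2 * Real.pi) + 1 ≤ M) :
    ‖β⁻¹ • ∑ i : MatsubaraIdx M, ∫ e,
        W e * klfb_prop f (matsubaraFreq β M i) e * klfb_prop f' (matsubaraFreq β M i + q₀) (e + σ e)‖ ≤
      64 / Real.pi * MF * LW * klScale klE0 n + 128 / Real.pi * MF * δW +
        393216 / Real.pi * (ℓ + 8 * MF) * BW * ((Real.pi / β) / klScale klE0 n) +
          (64 / Real.pi * Mf * BW * (K' * klScale klE0 n) * (|q₀| + δmax) +
            48 / Real.pi * Mf * BW * (K' * klScale klE0 n) * (|q₀| + δmax) * ((Real.pi / β) / klScale klE0 n)) := by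
  set Λ := klScale klE0 n with hΛdef
  have hΛ : 0 < Λ := klth_klScale_pos n
  have hr₁ : 0 < Λ / 2 := by positivity
  have hr : 0 < 4 * Λ := by positivity
  set ω : MatsubaraIdx M → ℝ := fun i => matsubaraFreq β M i with hω
  have hΦc : ∀ k₀, Continuous fun e => klfb_prop f k₀ e := fun k₀ => klfb_continuous_prop_snd hlip hbd hin hout hr₁ hr k₀
  have hΨc : ∀ k₀, Continuous fun e => klfb_prop f' k₀ e := fun k₀ => klfs_continuous_snd_of_lipschitz hΨlip k₀
  have hΨsc : ∀ k₀, Continuous fun e => klfb_prop f' (k₀ + q₀) (e + σ e) := fun k₀ =>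
    (hΨc (k₀ + q₀)).comp (continuous_id.add hσc)
  have hΦzero : ∀ k₀ e, 4 * Λ ≤ |e| → klfb_prop f k₀ e = 0 := fun k₀ e he => klfb_prop_eq_zero_of_le_abs hr.le hout k₀ he
  have hint1 : ∀ k₀ : ℝ, Integrable fun e : ℝ => W e * klfb_prop f k₀ e * klfb_prop f' k₀ e := by
    intro k₀
    have hcont : Continuous fun e : ℝ => W e * klfb_prop f k₀ e * klfb_prop f' k₀ e := (hW.mul (hΦc k₀)).mul (hΨc k₀)
    refine hcont.integrable_of_hasCompactSupport ?_
    refine HasCompactSupport.intro (isCompact_Icc (a := -(4 * Λ)) (b := 4 * Λ)) fun e he => ?_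
    rw [hΦzero k₀ e (klsp_le_abs_of_not_mem_Icc he), mul_zero, zero_mul]
  have hint2 : ∀ k₀ : ℝ, Integrable fun e : ℝ =>
      W e * klfb_prop f k₀ e * (klfb_prop f' (k₀ + q₀) (e + σ e) - klfb_prop f' k₀ e) := by
    intro k₀
    have hcont : Continuous fun e : ℝ => W e * klfb_prop f k₀ e * (klfb_prop f' (k₀ + q₀) (e + σ e) - klfb_prop f' k₀ e) :=
      (hW.mul (hΦc k₀)).mul ((hΨsc k₀).sub (hΨc k₀))
    refine hcont.integrable_of_hasCompactSupport ?_
    refine HasCompactSupport.intro (isCompact_Icc (a := -(4 * Λ)) (b := 4 * Λ)) fun e he => ?_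
    rw [hΦzero k₀ e (klsp_le_abs_of_not_mem_Icc he), mul_zero, zero_mul]
  have hsplit : ∀ i : MatsubaraIdx M,
      (∫ e, W e * klfb_prop f (ω i) e * klfb_prop f' (ω i + q₀) (e + σ e)) =
        (∫ e, W e * klfb_prop f (ω i) e * klfb_prop f' (ω i) e) +
          ∫ e, W e * klfb_prop f (ω i) e * (klfb_prop f' (ω i + q₀) (e + σ e) - klfb_prop f' (ω i) e) := by
    intro i
    rw [← integral_add (hint1 (ω i)) (hint2 (ω i))]
    refine integral_congr_ae (Filter.Eventually.of_forall fun e => ?_)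
    simp only
    ring
  have hzero_form : ∀ (k₀ e : ℝ), W e * klfb_prop f k₀ e * klfb_prop f' k₀ e =
      (f (k₀ ^ 2 + e ^ 2) * f' (k₀ ^ 2 + e ^ 2)) * ((-I * k₀ + e) ^ 2)⁻¹ * W e := by
    intro k₀ e
    simp only [klfb_prop]
    rw [klsp_div_propagator_eq f k₀ e, klsp_div_propagator_eq f' k₀ e]
    rw [show ((-I * (k₀ : ℂ) + e) ^ 2)⁻¹ = (-I * k₀ + e)⁻¹ * (-I * k₀ + e)⁻¹ by rw [sq, mul_inv]]
    ring
  have hsum : (β⁻¹ • ∑ i : MatsubaraIdx M, ∫ e, W e * klfb_prop f (ω i) e * klfb_prop f' (ω i + q₀) (e + σ e)) =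
      β⁻¹ • (∑ i : MatsubaraIdx M, ∫ e, (f (ω i ^ 2 + e ^ 2) * f' (ω i ^ 2 + e ^ 2)) * ((-I * (ω i) + e) ^ 2)⁻¹ * W e) +
        β⁻¹ • ∑ i : MatsubaraIdx M, ∫ e,
          W e * klfb_prop f (ω i) e * (klfb_prop f' (ω i + q₀) (e + σ e) - klfb_prop f' (ω i) e) := by
    rw [← smul_add, ← Finset.sum_add_distrib]
    congr 1
    refine Finset.sum_congr rfl fun i _ => ?_
    rw [hsplit i]
    congr 1
    refine integral_congr_ae (Filter.Eventually.of_forall fun e => ?_)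
    exact hzero_form (ω i) e
  have h1 := klte_slice_bubble_weighted_norm_le_sharp_quasi (F := fun s => f s * f' s) (W := W) hMF hFlip hFbd hLF
    (fun s hs => by simp only [hin s hs, zero_mul]) (fun s hs => by simp only [hout s hs, zero_mul])
    hW hLW hδW hBW hWlip hWbd hβ hn hM
  have hβ0 : 0 < β := pos_of_klBetaMin_le hβ
  have h2 := klfs_shift_norm_le_of_lipschitz_split (Ψ := klfb_prop f') hbd hin hout hK' hΨlip hBW hWbd hδ0 hσ q₀ hβ0 M
  change ‖β⁻¹ • ∑ i : MatsubaraIdx M, ∫ e, W e * klfb_prop f (ω i) e * klfb_prop f' (ω i + q₀) (e + σ e)‖ ≤ _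
  rw [hsum]
  refine (norm_add_le _ _).trans ?_
  exact add_le_add h1 h2

/-- **Window form** of `klfs_transfer_norm_le_of_lipschitz_coreTCQ`: `W` and the shift `σ` only continuous / bounded ON `[−4Λₙ, 4Λₙ]` (clamping). -/
theorem klfs_transfer_norm_le_of_lipschitzTCQ
    (hlip : ∀ s s', ‖f s - f s'‖ ≤ Lf * |s - s'|) (hbd : ∀ s, ‖f s‖ ≤ Mf) {n : ℕ}
    (hin : ∀ s, s ≤ (klScale klE0 n / 2) ^ 2 → f s = 0) (hout : ∀ s, (4 * klScale klE0 n) ^ 2 ≤ s → f s = 0)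
    (hK' : 0 ≤ K') (hΨlip : ∀ k₀ e k₀' e', ‖klfb_prop f' k₀ e - klfb_prop f' k₀' e'‖ ≤ K' * (|k₀ - k₀'| + |e - e'|))
    (hMF : 0 ≤ MF) (hFlip : ∀ s s', ‖f s * f' s - f s' * f' s'‖ ≤ LF * |s - s'|) (hFbd : ∀ s, ‖f s * f' s‖ ≤ MF)
    (hLF : LF ≤ ℓ / klScale klE0 n ^ 2)
    (hW : ContinuousOn W (Icc (-(4 * klScale klE0 n)) (4 * klScale klE0 n))) (hLW : 0 ≤ LW) (hδW : 0 ≤ δW) (hBW : 0 ≤ BW)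
    (hWlip : ∀ e : ℝ, |e| < 4 * klScale klE0 n → ‖W e - W 0‖ ≤ LW * |e| + δW)
    (hWbd : ∀ e, |e| < 4 * klScale klE0 n → ‖W e‖ ≤ BW)
    (hσc : ContinuousOn σ (Icc (-(4 * klScale klE0 n)) (4 * klScale klE0 n))) (hδ0 : 0 ≤ δmax)
    (hσ : ∀ e, |e| ≤ 4 * klScale klE0 n → |σ e| ≤ δmax)
    (q₀ : ℝ) {β : ℝ} (hβ : klBetaMin ≤ β) (hn : n ≤ nScales β + 1) {M : ℕ}
    (hM : β * (4 * klScale klE0 n) / (2 * Real.pi) + 1 ≤ M) :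
    ‖β⁻¹ • ∑ i : MatsubaraIdx M, ∫ e,
        W e * klfb_prop f (matsubaraFreq β M i) e * klfb_prop f' (matsubaraFreq β M i + q₀) (e + σ e)‖ ≤
      64 / Real.pi * MF * LW * klScale klE0 n + 128 / Real.pi * MF * δW +
        393216 / Real.pi * (ℓ + 8 * MF) * BW * ((Real.pi / β) / klScale klE0 n) +
          (64 / Real.pi * Mf * BW * (K' * klScale klE0 n) * (|q₀| + δmax) +
            48 / Real.pi * Mf * BW * (K' * klScale klE0 n) * (|q₀| + δmax) * ((Real.pi / β) / klScale klE0 n)) := by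
  set r := 4 * klScale klE0 n with hr_def
  have hΛ := klth_klScale_pos n
  have hr : 0 ≤ r := by positivity
  set W' : ℝ → ℂ := fun e => W (max (-r) (min r e)) with hW'
  set σ' : ℝ → ℝ := fun e => σ (max (-r) (min r e)) with hσ'
  have hW'c : Continuous W' := klsw_continuous_comp_clamp hr hW
  have hσ'c : Continuous σ' := klsw_continuous_comp_clamp hr hσc
  have hW'eq : ∀ e, |e| < r → W' e = W e := fun e he => by simp only [hW', Literature.Analysis.FunctionSpaces.max_neg_min_eq_self he.le]
  have hσ'eq : ∀ e, |e| < r → σ' e = σ e := fun e he => by simp only [hσ', Literature.Analysis.FunctionSpaces.max_neg_min_eq_self he.le]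
  have hW'0 : W' 0 = W 0 := by
    simp only [hW', Literature.Analysis.FunctionSpaces.max_neg_min_eq_self (show |(0:ℝ)| ≤ r by simpa using hr)]
  have hW'lip : ∀ e : ℝ, |e| < r → ‖W' e - W' 0‖ ≤ LW * |e| + δW := fun e he => by rw [hW'eq e he, hW'0]; exact hWlip e he
  have hW'bd : ∀ e : ℝ, |e| < r → ‖W' e‖ ≤ BW := fun e he => by rw [hW'eq e he]; exact hWbd e he
  have hσ'bd : ∀ e, |σ' e| ≤ δmax := fun e =>
    hσ _ (abs_le.mpr ⟨(klsw_clamp_mem hr e).1, (klsw_clamp_mem hr e).2⟩)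
  have hΦzero : ∀ (k₀ e : ℝ), r ≤ |e| → klfb_prop f k₀ e = 0 := fun k₀ e he => klfb_prop_eq_zero_of_le_abs hr hout k₀ he
  have hpt : ∀ (k₀ e : ℝ), W e * klfb_prop f k₀ e * klfb_prop f' (k₀ + q₀) (e + σ e) =
      W' e * klfb_prop f k₀ e * klfb_prop f' (k₀ + q₀) (e + σ' e) := by
    intro k₀ e
    by_cases he : |e| < r
    · rw [hW'eq e he, hσ'eq e he]
    · rw [hΦzero k₀ e (not_lt.mp he), mul_zero, zero_mul, mul_zero, zero_mul]
  simp_rw [hpt]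
  exact klfs_transfer_norm_le_of_lipschitz_coreTCQ hlip hbd hin hout hK' hΨlip hMF hFlip hFbd hLF hW'c hLW hδW hBW hW'lip hW'bd hσ'c hδ0
    hσ'bd q₀ hβ hn hM
end Transfer

/-! ## §2 On the frame band: per-ray (tube-local quasi-Lipschitz data) and planar (angle profiles) bounds -/

section Frame
variable {a b : ℝ} (B : BandBounds a b) {δ : (Fin 2 → ℝ) → ℝ} (hδ1 : ContDiff ℝ 1 δ) {κ₀ κ₁ : ℝ}
  (hδ : ∀ k : Fin 2 → ℝ, (∀ i, |k i| ≤ π) → |δ k| ≤ κ₀)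
  (hκ : ∀ k : Fin 2 → ℝ, (∀ i, |k i| ≤ π) → ‖fderiv ℝ δ k‖ ≤ κ₁) (hκ₁ : κ₁ < B.Dtmin)

include B hδ1 hδ hκ hκ₁ in
/-- **THE SOFT FORWARD SLICE BUBBLE ON ONE RAY WITH TUBE-LOCAL QUASI-LIPSCHITZ VERTEX DATA** (sharp zero-sound term, split count): `klfs_ray_bubble_norm_le_of_lipschitzTC` with the
vertex weight's sup `A₀` and radial quasi-Lipschitz datum `‖A(t·dir θ) − A(t'·dir θ)‖ ≤ A₁|t − t'| + δ_A` asked only for `t, t' ≥ 0` on the TUBE segment of the ray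
(`|band| < 4Λₙ`); the bound gains the SCALE-FREE defect `(128/π)·M_F·(π√2/(Dt_min − κ₁))·δ_A`. -/
theorem klfs_ray_bubble_norm_le_of_lipschitzTCQ {A : ℝ × ℝ → ℂ} (hA : Continuous A)
    (hAsupp : ∀ p : ℝ × ℝ, A p ≠ 0 → |p.1| < π ∧ |p.2| < π) (θ : ℝ) {n : ℕ} {μ : ℝ} {A₀ A₁ δA : ℝ}
    (hA0' : 0 ≤ A₀) (hA1' : 0 ≤ A₁) (hδA : 0 ≤ δA)
    (hA0 : ∀ t : ℝ, 0 ≤ t → |klfb_band δ μ (t * Real.cos θ, t * Real.sin θ)| < 4 * klScale klE0 n → ‖A (t * Real.cos θ, t * Real.sin θ)‖ ≤ A₀)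
    (hA1 : ∀ t t' : ℝ, 0 ≤ t → 0 ≤ t' → |klfb_band δ μ (t * Real.cos θ, t * Real.sin θ)| < 4 * klScale klE0 n →
      |klfb_band δ μ (t' * Real.cos θ, t' * Real.sin θ)| < 4 * klScale klE0 n →
      ‖A (t * Real.cos θ, t * Real.sin θ) - A (t' * Real.cos θ, t' * Real.sin θ)‖ ≤ A₁ * |t - t'| + δA)
    {κ₂ : ℝ} (hκ₂ : 0 ≤ κ₂)
    (hD2 : ∀ s t : ℝ, s ∈ Icc 0 (π / ‖dir θ‖) → t ∈ Icc 0 (π / ‖dir θ‖) →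
      |fderiv ℝ δ (s • dir θ) (dir θ) - fderiv ℝ δ (t • dir θ) (dir θ)| ≤ κ₂ * |s - t|)
    {f f' : ℝ → ℂ} {Lf Mf K' LF MF ℓ : ℝ}
    (hlip : ∀ s s', ‖f s - f s'‖ ≤ Lf * |s - s'|) (hbd : ∀ s, ‖f s‖ ≤ Mf)
    (hin : ∀ s, s ≤ (klScale klE0 n / 2) ^ 2 → f s = 0) (hout : ∀ s, (4 * klScale klE0 n) ^ 2 ≤ s → f s = 0)
    (hK' : 0 ≤ K') (hΨlip : ∀ k₀ e k₀' e', ‖klfb_prop f' k₀ e - klfb_prop f' k₀' e'‖ ≤ K' * (|k₀ - k₀'| + |e - e'|))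
    (hMF : 0 ≤ MF) (hFlip : ∀ s s', ‖f s * f' s - f s' * f' s'‖ ≤ LF * |s - s'|) (hFbd : ∀ s, ‖f s * f' s‖ ≤ MF)
    (hLF : LF ≤ ℓ / klScale klE0 n ^ 2)
    {e' : ℝ × ℝ → ℝ} (he' : Continuous e') {δmax : ℝ} (hδ0 : 0 ≤ δmax)
    (he'δ : ∀ p : ℝ × ℝ, |p.1| < π → |p.2| < π → |e' p - klfb_band δ μ p| ≤ δmax)
    (hlo : a < μ - 4 * klScale klE0 n - κ₀) (hhi : μ + 4 * klScale klE0 n + κ₀ < b)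
    (q₀ : ℝ) {β : ℝ} (hβ : klBetaMin ≤ β) (hn : n ≤ nScales β + 1) {M : ℕ}
    (hM : β * (4 * klScale klE0 n) / (2 * Real.pi) + 1 ≤ M) :
    ‖β⁻¹ • ∑ i : MatsubaraIdx M, ∫ t in Ioi (0 : ℝ),
        t • klfb_integrand δ μ A f f' e' (matsubaraFreq β M i) q₀ (t * Real.cos θ, t * Real.sin θ)‖ ≤
      64 / Real.pi * MF *
          (Real.pi * Real.sqrt 2 / (B.Dtmin - κ₁) * A₁ / (B.Dtmin - κ₁) +
            A₀ * (1 / (B.Dtmin - κ₁) ^ 2 + Real.pi * Real.sqrt 2 * (2 + κ₂) / (B.Dtmin - κ₁) ^ 3)) * klScale klE0 n +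
        128 / Real.pi * MF * (Real.pi * Real.sqrt 2 / (B.Dtmin - κ₁) * δA) +
        393216 / Real.pi * (ℓ + 8 * MF) * (A₀ * (Real.pi * Real.sqrt 2 / (B.Dtmin - κ₁))) * ((Real.pi / β) / klScale klE0 n) +
          (64 / Real.pi * Mf * (A₀ * (Real.pi * Real.sqrt 2 / (B.Dtmin - κ₁))) * (K' * klScale klE0 n) * (|q₀| + δmax) +
            48 / Real.pi * Mf * (A₀ * (Real.pi * Real.sqrt 2 / (B.Dtmin - κ₁))) * (K' * klScale klE0 n) * (|q₀| + δmax) *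
              ((Real.pi / β) / klScale klE0 n)) := by
  have hδc : Continuous δ := hδ1.continuous
  have hΛ := klth_klScale_pos n
  have hr₁ : 0 < klScale klE0 n / 2 := by positivity
  have hr : 0 < 4 * klScale klE0 n := by positivity
  have hd : 0 < B.Dtmin - κ₁ := by linarith
  have hκ₀ : 0 ≤ κ₀ := (abs_nonneg _).trans (hδ 0 (fun i => by simp [Real.pi_pos.le]))
  have hμlo : a ≤ μ - κ₀ := by linarith
  have hμhi : μ + κ₀ ≤ b := by linarith
  have hray : ∀ i : MatsubaraIdx M, ∫ t in Ioi (0 : ℝ),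
      t • klfb_integrand δ μ A f f' e' (matsubaraFreq β M i) q₀ (t * Real.cos θ, t * Real.sin θ) =
        ∫ e : ℝ, klfb_weight δ μ A θ e * klfb_prop f (matsubaraFreq β M i) e *
          klfb_prop f' (matsubaraFreq β M i + q₀) (e + klfb_shift δ μ e' θ e) := fun i =>
    klfs_ray_bubble_integral_eq B hδ1 hδ hκ hκ₁ hA hAsupp hlip hbd hin hout hr₁ hr hΨlip he' hlo hhi _ q₀ θ
  rw [Finset.sum_congr rfl fun i _ => hray i]
  have hW : ContinuousOn (klfb_weight δ μ A θ) (Icc (-(4 * klScale klE0 n)) (4 * klScale klE0 n)) :=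
    klfb_weight_continuousOn B hδ1 hδ hκ hκ₁ hA hlo hhi θ
  have hWlip : ∀ e : ℝ, |e| < 4 * klScale klE0 n → ‖klfb_weight δ μ A θ e - klfb_weight δ μ A θ 0‖ ≤
      (Real.pi * Real.sqrt 2 / (B.Dtmin - κ₁) * A₁ / (B.Dtmin - κ₁) +
          A₀ * (1 / (B.Dtmin - κ₁) ^ 2 + Real.pi * Real.sqrt 2 * (2 + κ₂) / (B.Dtmin - κ₁) ^ 3)) * |e| +
        Real.pi * Real.sqrt 2 / (B.Dtmin - κ₁) * δA := by
    intro e he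
    have he' := abs_lt.mp he
    exact klfb_weight_sub_zero_norm_le_tube_quasi B hδ1 hδ hκ hκ₁ hA1' hA0 hA1 hκ₂ hD2 he hμlo hμhi (by linarith) (by linarith)
  have hWbd : ∀ e : ℝ, |e| < 4 * klScale klE0 n → ‖klfb_weight δ μ A θ e‖ ≤ A₀ * (Real.pi * Real.sqrt 2 / (B.Dtmin - κ₁)) := by
    intro e he
    have he' := abs_lt.mp he
    exact klfb_weight_norm_le_tube B hδ hκ hκ₁ hδc hA0' θ hA0 he (by linarith) (by linarith)
  have hσc : ContinuousOn (klfb_shift δ μ e' θ) (Icc (-(4 * klScale klE0 n)) (4 * klScale klE0 n)) :=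
    klfb_shift_continuousOn B hδ1 hδ hκ hκ₁ he' hlo hhi θ
  have hσ : ∀ e : ℝ, |e| ≤ 4 * klScale klE0 n → |klfb_shift δ μ e' θ e| ≤ δmax := by
    intro e he
    have he' := abs_le.mp he
    exact klfb_shift_abs_le B hδ hδc he'δ (by linarith) (by linarith) θ
  have hLW : 0 ≤ Real.pi * Real.sqrt 2 / (B.Dtmin - κ₁) * A₁ / (B.Dtmin - κ₁) +
      A₀ * (1 / (B.Dtmin - κ₁) ^ 2 + Real.pi * Real.sqrt 2 * (2 + κ₂) / (B.Dtmin - κ₁) ^ 3) := by positivity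
  have hBW : 0 ≤ A₀ * (Real.pi * Real.sqrt 2 / (B.Dtmin - κ₁)) := by positivity
  have hδW : 0 ≤ Real.pi * Real.sqrt 2 / (B.Dtmin - κ₁) * δA := by positivity
  exact klfs_transfer_norm_le_of_lipschitzTCQ hlip hbd hin hout hK' hΨlip hMF hFlip hFbd hLF hW hLW hδW hBW hWlip hWbd hσc hδ0 hσ q₀ hβ hn hM

include B hδ1 hδ hκ hκ₁ in
/-- **THE SOFT PLANAR FORWARD BUBBLE WITH ANGLE-DEPENDENT, TUBE-LOCAL QUASI-LIPSCHITZ VERTEX DATA** (sharp zero-sound term, split count): `klfs_planar_bubble_norm_le_of_lipschitzTC`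
with sup / radial data given PER RAY as integrable angle profiles `A₀(θ)`, `A₁(θ)|t − t'| + δ_A(θ)` on the tube segments; the planar bound is the θ-integral of the per-ray bound. -/
theorem klfs_planar_bubble_norm_le_of_lipschitzTCQ {A : ℝ × ℝ → ℂ} (hA : Continuous A) (hAsupp : ∀ p : ℝ × ℝ, A p ≠ 0 → |p.1| < π ∧ |p.2| < π)
    {n : ℕ} {μ : ℝ} {A₀ A₁ δA : ℝ → ℝ} (hA0' : ∀ θ, 0 ≤ A₀ θ) (hA1' : ∀ θ, 0 ≤ A₁ θ) (hδA' : ∀ θ, 0 ≤ δA θ)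
    (hA0i : IntegrableOn A₀ (Ioo (-π) π)) (hA1i : IntegrableOn A₁ (Ioo (-π) π)) (hδAi : IntegrableOn δA (Ioo (-π) π))
    (hA0 : ∀ θ t : ℝ, 0 ≤ t → |klfb_band δ μ (t * Real.cos θ, t * Real.sin θ)| < 4 * klScale klE0 n → ‖A (t * Real.cos θ, t * Real.sin θ)‖ ≤ A₀ θ)
    (hA1 : ∀ θ t t' : ℝ, 0 ≤ t → 0 ≤ t' → |klfb_band δ μ (t * Real.cos θ, t * Real.sin θ)| < 4 * klScale klE0 n →
      |klfb_band δ μ (t' * Real.cos θ, t' * Real.sin θ)| < 4 * klScale klE0 n →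
      ‖A (t * Real.cos θ, t * Real.sin θ) - A (t' * Real.cos θ, t' * Real.sin θ)‖ ≤ A₁ θ * |t - t'| + δA θ)
    {κ₂ : ℝ} (hκ₂ : 0 ≤ κ₂)
    (hD2 : ∀ θ s t : ℝ, s ∈ Icc 0 (π / ‖dir θ‖) → t ∈ Icc 0 (π / ‖dir θ‖) →
      |fderiv ℝ δ (s • dir θ) (dir θ) - fderiv ℝ δ (t • dir θ) (dir θ)| ≤ κ₂ * |s - t|)
    {f f' : ℝ → ℂ} {Lf Mf K' LF MF ℓ : ℝ}
    (hlip : ∀ s s', ‖f s - f s'‖ ≤ Lf * |s - s'|) (hbd : ∀ s, ‖f s‖ ≤ Mf)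
    (hin : ∀ s, s ≤ (klScale klE0 n / 2) ^ 2 → f s = 0) (hout : ∀ s, (4 * klScale klE0 n) ^ 2 ≤ s → f s = 0)
    (hK' : 0 ≤ K') (hΨlip : ∀ k₀ e k₀' e', ‖klfb_prop f' k₀ e - klfb_prop f' k₀' e'‖ ≤ K' * (|k₀ - k₀'| + |e - e'|))
    (hMF : 0 ≤ MF) (hFlip : ∀ s s', ‖f s * f' s - f s' * f' s'‖ ≤ LF * |s - s'|) (hFbd : ∀ s, ‖f s * f' s‖ ≤ MF)
    (hLF : LF ≤ ℓ / klScale klE0 n ^ 2)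
    {e' : ℝ × ℝ → ℝ} (he' : Continuous e') {δmax : ℝ} (hδ0 : 0 ≤ δmax)
    (he'δ : ∀ p : ℝ × ℝ, |p.1| < π → |p.2| < π → |e' p - klfb_band δ μ p| ≤ δmax)
    (hlo : a < μ - 4 * klScale klE0 n - κ₀) (hhi : μ + 4 * klScale klE0 n + κ₀ < b)
    (q₀ : ℝ) {β : ℝ} (hβ : klBetaMin ≤ β) (hn : n ≤ nScales β + 1) {M : ℕ}
    (hM : β * (4 * klScale klE0 n) / (2 * Real.pi) + 1 ≤ M) :
    ‖β⁻¹ • ∑ i : MatsubaraIdx M, ∫ p : ℝ × ℝ, klfb_integrand δ μ A f f' e' (matsubaraFreq β M i) q₀ p‖ ≤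
      ∫ θ in Ioo (-π) π,
        (64 / Real.pi * MF *
            (Real.pi * Real.sqrt 2 / (B.Dtmin - κ₁) * A₁ θ / (B.Dtmin - κ₁) +
              A₀ θ * (1 / (B.Dtmin - κ₁) ^ 2 + Real.pi * Real.sqrt 2 * (2 + κ₂) / (B.Dtmin - κ₁) ^ 3)) * klScale klE0 n +
          128 / Real.pi * MF * (Real.pi * Real.sqrt 2 / (B.Dtmin - κ₁) * δA θ) +
          393216 / Real.pi * (ℓ + 8 * MF) * (A₀ θ * (Real.pi * Real.sqrt 2 / (B.Dtmin - κ₁))) * ((Real.pi / β) / klScale klE0 n) +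
            (64 / Real.pi * Mf * (A₀ θ * (Real.pi * Real.sqrt 2 / (B.Dtmin - κ₁))) * (K' * klScale klE0 n) * (|q₀| + δmax) +
              48 / Real.pi * Mf * (A₀ θ * (Real.pi * Real.sqrt 2 / (B.Dtmin - κ₁))) * (K' * klScale klE0 n) * (|q₀| + δmax) *
                ((Real.pi / β) / klScale klE0 n))) := by
  have hδc : Continuous δ := hδ1.continuous
  have hΛ := klth_klScale_pos n
  have hr₁ : 0 < klScale klE0 n / 2 := by positivity
  have hr : 0 < 4 * klScale klE0 n := by positivity
  have hcs := klfb_hasCompactSupport_of_square hAsupp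
  have hint : ∀ i : MatsubaraIdx M, Integrable (klfb_integrand δ μ A f f' e' (matsubaraFreq β M i) q₀) := by
    intro i
    have hc := klfs_continuous_integrand hδc hA hlip hbd hin hout hr₁ hr hΨlip he' μ (matsubaraFreq β M i) q₀
    refine hc.integrable_of_hasCompactSupport ?_
    unfold klfb_integrand
    exact (hcs.mul_right).mul_right
  have hBi : IntegrableOn (fun θ =>
      64 / Real.pi * MF *
            (Real.pi * Real.sqrt 2 / (B.Dtmin - κ₁) * A₁ θ / (B.Dtmin - κ₁) +
              A₀ θ * (1 / (B.Dtmin - κ₁) ^ 2 + Real.pi * Real.sqrt 2 * (2 + κ₂) / (B.Dtmin - κ₁) ^ 3)) * klScale klE0 n +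
          128 / Real.pi * MF * (Real.pi * Real.sqrt 2 / (B.Dtmin - κ₁) * δA θ) +
          393216 / Real.pi * (ℓ + 8 * MF) * (A₀ θ * (Real.pi * Real.sqrt 2 / (B.Dtmin - κ₁))) * ((Real.pi / β) / klScale klE0 n) +
            (64 / Real.pi * Mf * (A₀ θ * (Real.pi * Real.sqrt 2 / (B.Dtmin - κ₁))) * (K' * klScale klE0 n) * (|q₀| + δmax) +
              48 / Real.pi * Mf * (A₀ θ * (Real.pi * Real.sqrt 2 / (B.Dtmin - κ₁))) * (K' * klScale klE0 n) * (|q₀| + δmax) *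
                ((Real.pi / β) / klScale klE0 n))) (Ioo (-π) π) := by
    have h1 : IntegrableOn (fun θ => Real.pi * Real.sqrt 2 / (B.Dtmin - κ₁) * A₁ θ / (B.Dtmin - κ₁)) (Ioo (-π) π) :=
      (hA1i.const_mul (Real.pi * Real.sqrt 2 / (B.Dtmin - κ₁))).div_const (B.Dtmin - κ₁)
    have h2 : IntegrableOn (fun θ => A₀ θ * (1 / (B.Dtmin - κ₁) ^ 2 + Real.pi * Real.sqrt 2 * (2 + κ₂) / (B.Dtmin - κ₁) ^ 3))
        (Ioo (-π) π) := hA0i.mul_const _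
    have h3 : IntegrableOn (fun θ => A₀ θ * (Real.pi * Real.sqrt 2 / (B.Dtmin - κ₁))) (Ioo (-π) π) := hA0i.mul_const _
    have h4 : IntegrableOn (fun θ => Real.pi * Real.sqrt 2 / (B.Dtmin - κ₁) * δA θ) (Ioo (-π) π) := hδAi.const_mul _
    exact (((((h1.add h2).const_mul _).mul_const _).add (h4.const_mul _)).add ((h3.const_mul _).mul_const _)).add
      ((((h3.const_mul _).mul_const _).mul_const _).add ((((h3.const_mul _).mul_const _).mul_const _).mul_const _))
  exact klry_norm_smul_sum_integral_le_of_ray_bound_fn hint hBi fun θ _ =>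
    klfs_ray_bubble_norm_le_of_lipschitzTCQ B hδ1 hδ hκ hκ₁ hA hAsupp θ (hA0' θ) (hA1' θ) (hδA' θ) (hA0 θ) (hA1 θ) hκ₂ (hD2 θ) hlip hbd hin hout
      hK' hΨlip hMF hFlip hFbd hLF he' hδ0 he'δ hlo hhi q₀ hβ hn hM

end Frame

end Summit.HubbardSuperconductivity.HubbardSuperconductivity.Theorems.KLRegimeSplit

end
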